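import Mathlib
import Literature.Analysis.FluidPDE.VectorCalculus
import Summits.NavierStokesRegularity.NavierStokesRegularity.Theorems.SkeletonEquilibrium.Negative.StrainIdentity

/-!
# The stretching identity along a tangent filament (stub `stub_stretchingIdentity`, line `Sketch`)

Tools stub of line `Sketch` for the crux `FilamentSkeletonRss.SkeletonEquilibrium`
(stmt-NavierStokesRegularity-15400). Along a unit-speed `C²` curve `X` on which the total velocity
of the rotating Leray frame, `u(X τ) + ½ X τ − α e₃ × X τ`, is tangent with slip `w`
(`= w τ • X′ τ`), the slip derivative is

`w′(τ) = ½ + ⟪X′(τ), Du(X τ) X′(τ)⟫`,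

i.e. stretching minus the Leray `½` is the AXIAL STRAIN of `u` along the filament; the frame
rotation `α` drops out (`⟪e₃ × X′, X′⟫ = 0`) and so does the curvature (`⟪X′, X″⟫ = 0`).

Proof: this is the landed strain identity
`…Theorems.SkeletonEquilibrium.Negative.strain_identity` (valid for ANY differentiable induced
velocity `F` along the curve, `w′ = ½ + ⟪F′, X′⟫`) specialised to `F = u ∘ X`, whose derivative is
`Du(X τ) (X′ τ)` by the chain rule. Nothing is re-proved here.
-/

namespace Summit.NavierStokesRegularity.NavierStokesRegularity.Theorems.SkeletonEquilibrium.Sketch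
set_option linter.dupNamespace false

noncomputable section

open Literature.Analysis.FluidPDE
open scoped RealInnerProductSpace

/-- **Stretching identity.** Let `u : ℝ³ → ℝ³` be differentiable, `X : ℝ → ℝ³` a unit-speed `C²`
curve and `w : ℝ → ℝ` differentiable with
`u (X τ) + (½ X τ − α e₃ × X τ) = w τ • X′ τ` for all `τ` (the frame velocity is tangent along
the filament, with slip `w`). Then `w′ τ = ½ + ⟪X′ τ, Du(X τ) (X′ τ)⟫` for every `τ`: the Leray
drift contributes exactly `½`, the rotation and the curvature nothing. (Corollary of
`Negative.strain_identity` with `F = u ∘ X` and the chain rule.) [folklore] -/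
theorem stub_stretchingIdentity : ∀ (α : ℝ) (u : EuclideanSpace ℝ (Fin 3) → EuclideanSpace ℝ (Fin 3)) (X : ℝ → EuclideanSpace ℝ (Fin 3)) (w : ℝ → ℝ), Differentiable ℝ u → ContDiff ℝ 2 X → Differentiable ℝ w → (∀ τ, ‖deriv X τ‖ = 1) → (∀ τ, u (X τ) + ((1 / 2 : ℝ) • X τ - α • Literature.Analysis.FluidPDE.cross (EuclideanSpace.single (2 : Fin 3) (1 : ℝ)) (X τ)) = w τ • deriv X τ) → ∀ τ, deriv w τ = 1 / 2 + inner ℝ (deriv X τ) (fderiv ℝ u (X τ) (deriv X τ)) := by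
  intro α u X w hu hX _hw hunit heq τ
  have hXd : Differentiable ℝ X := hX.differentiable (by norm_num)
  have hF : Differentiable ℝ (u ∘ X) := hu.comp hXd
  -- chain rule: `(u ∘ X)′ τ = Du(X τ) (X′ τ)`
  have hchain : deriv (u ∘ X) τ = fderiv ℝ u (X τ) (deriv X τ) :=
    ((hu (X τ)).hasFDerivAt.comp_hasDerivAt τ (hXd τ).hasDerivAt).deriv
  have h := Negative.strain_identity (α := α) (F := u ∘ X) (w := w) hX hunit hF
    (fun σ => heq σ) τ
  rw [h, hchain, real_inner_comm]

end

end Summit.NavierStokesRegularity.NavierStokesRegularity.Theorems.SkeletonEquilibrium.Sketch
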